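/-
Copyright (c) 2026. All rights reserved.
Released under Apache 2.0 license as described in the file LICENSE.
Authors: abc-iut cell, wave-4 seat abc-iut-w4-d059 (proof-only; the `Π^temp_𝔾`-level inputs of the
(AI3) edge dictionary of row T54-0b — `hEstabN`, `hErigid`, `hEinj`, `huniqN` of
`mem_arithBrGp_iff_fixes_pair` — DISCHARGED from the two-sided edge dictionary, the finite levels and
total estrangement; no `CompactInVerticial`).
-/
import Literature.AnabelianGeometry.SemiGraphs.ArithEdgeStabilizerInputs
import Literature.AnabelianGeometry.SemiGraphs.TemperedMaximalCompact
import HarnessLib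

/-!
# (compact-`C` twin, α12-1)  [SemiAnbd] §5 p. 65 / Thm 5.4 (i): the pro-branch as an eventual edge system, and the geometric
# inputs of the (AI3) edge dictionary discharged from edge data and total estrangement (proof-only)

Mochizuki, *Semi-graphs of anabelioids*, Publ. RIMS **42** (2006), §5 p. 65 ("`Π^temp_{𝔊,b} ⊆ Π^temp_{𝔊,v}`
… may be thought of as the commensurator in `Π^temp_{𝔊,v}` of `Π^temp_{𝔾,b}`") and the proofs of Thm 3.7
(iii) p. 41 / Thm 5.4 (i) p. 66 with the author's Comments (6)(b)(c): the decomposition groups are the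
stabilisers of compatible systems of vertices / edges of the universal graph-coverings `T_j` of the finite
levels, and a nontrivial subgroup fixing a compatible system of branch-pairs of the finite levels is
impossible "in light of our assumption that `𝒢` is totally estranged". [cite: MochizukiSemiAnbd2006, §5, p. 65]

PROOF-ONLY sequel to `ArithBrGpStabilizer.lean` / `ArithEdgeStabilizer.lean` (abc-iut cell, sub-DAG `plan/L3/SUBDAG-SemiAnbd-Thm54.md`,
row **T54-0b (AI3) edge twin**, seat abc-iut-w4-d059; producer/packager abc-iut-w4-d053).  There the
arithmetic branch group `arithBrGp R ι b` was identified with the stabiliser of an ADJACENT PAIR `(x, y)`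
of compatible tree-vertex systems, relative to an abstract adjacency relation and four inputs about the
restricted action of `N = Π^temp_𝔾`: `hEstabN`, `hErigid`, `hEinj` (and `huniqN`).  Here:

* the adjacency relation is fixed to its geometric meaning — "`x`, `y` are the two end-vertex systems of
  an eventual system of tree edges `ε_j` with its two branch systems `c_j`, `c'_j`" (the data recorded by
  the field `edgeFix` of abc-iut-w4-d053's `ArithLevelData`; the `hends` shape of this seat's
  `ArithEdgeStabilizer.lean`, whose tree combinatorics `edgeSystem_fixed_iff_ends_fixed` is reused;
  `edges_compatible_of_ends` adds that the edges themselves are compatible);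
* `not_three_fixed_of_ne_bot`: a NONTRIVIAL subgroup of `Π^temp_𝔾` fixes no three pairwise-somewhere-
  different compatible vertex systems — from the finite levels (`levelAct`, `quot`, `levelTrans`) and the
  estrangement input `hnobp` ("no nontrivial subgroup fixes a compatible finite-level branch-pair
  system", the conclusion of abc-iut-L3-t11's `noFixedBranchPairSystem_of_isTotallyEstranged'`, itself
  recorded here as `hnobp_of_stabBranchPair` from the (I4′)-shaped identification), via
  `SemiGraph.hstar_of_noFixedBranchPairSystem` and `SemiGraph.atMostTwo_systems_of_hstar`;
* the four inputs DISCHARGED: `hEstabN_of_edgeData` (from the two-sided edge dictionary (I3):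
  the full stabiliser of an eventual compatible edge system IS a §3 edge-like subgroup), `hEinj_of_edgeData`
  and `hErigid_of_edgeData` (edge-like subgroups are infinite, Thm 3.7 (i)(ii) discharged, plus
  `not_three_fixed_of_ne_bot`; `hErigid` uses the converse dictionary `hedgeFixN`: every edge-like
  subgroup IS such a stabiliser), `huniqN_of_levelData` (abc-iut-w4-d059's `huniqN_of_edgeData` with the
  finiteness of stars read off the immersions `quot j` into the finite levels).

All inputs are level-data-shaped statements about the GEOMETRIC tempered group acting on its own trees
(producer row T54-B); no `CompactInVerticial` (Thm 3.7 (iii) as typed) is used.  No definition, no new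
named fact; nothing here takes a side on [IUTchIII] Cor. 3.12; typed ≠ proved elsewhere.

COMPACT-`C` TWIN (α12-1 disposition of FINDING F-d029g3-1, abc-iut-w4-d029 g3, 2026-08-26): the
estrangement input is taken in the dischargeable form `hnobpNCpt : ∀ C, IsCompact C → (C fixes a compatible
finite-level branch-pair system) → C = ⊥` — the all-subgroups form `hnobpN` of the untwinned file is FALSE over
towers whose finite levels do not separate points (the joint kernel fixes every system).  Every application
is at a COMPACT subgroup (edge-like subgroups and their pairwise meets, `isCompact_of_mem_edgeLikeSubgroups`),
so the proofs are those of the untwinned file verbatim with `IsCompact` threaded; `_cpt` names throughout.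
-/

namespace Literature.AnabelianGeometry.SemiGraphs

open CategoryTheory
open scoped Pointwise

universe v u u'

/-! ### The edges joining two compatible end systems are compatible (any transition morphisms) -/

/-! ### The restricted action of `Π^temp_𝔾`: no three fixed systems, and the four inputs discharged -/

namespace ProfiniteSemiGraph

variable {𝒢 : ProfiniteSemiGraph.{u}} {c : TemperedPiChart 𝒢} {Gtp : Type u'} [Group Gtp]
  (ι : c.G →* Gtp) {J : Type v} [Preorder J] [IsDirectedOrder J]
  (T : J → SemiGraph.{u}) (ρ : ∀ j, Gtp →* Aut (T j)) (f : ∀ ⦃i j : J⦄, i ≤ j → (T j ⟶ T i))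
  (level : J → SemiGraph.{u}) [∀ j, Finite (level j).Vertex] [∀ j, Finite (level j).Branch]
  (levelAct : ∀ j, Gtp →* Aut (level j)) (quot : ∀ j, T j ⟶ level j)
  (levelTrans : ∀ ⦃i j : J⦄, i ≤ j → (level j ⟶ level i))

/-- **A nontrivial subgroup of `Π^temp_𝔾` fixes no three pairwise-somewhere-different compatible systems
of tree vertices** (Comments (6)(b)(c) "in light of our assumption that `𝒢` is totally estranged"): the
finite levels `𝔾_j` (finite, with the immersions `quot j : T_j → 𝔾_j`, induced actions and functorial
equivariant transitions — fields of abc-iut-w4-d053's `ArithLevelData`) and the estrangement input `hnobpNCpt`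
for the restricted action ("no nontrivial subgroup of `Π^temp_𝔾` fixes a compatible finite-level
branch-pair system" — the conclusion of abc-iut-L3-t11's `noFixedBranchPairSystem_of_isTotallyEstranged'`)
give (∗_j) for `K ≠ 1` (`SemiGraph.hstar_of_noFixedBranchPairSystem`), whence at most two fixed systems
(`SemiGraph.atMostTwo_systems_of_hstar`). [cite: MochizukiSemiAnbd2006, Thm 3.7(iii) p.41] -/
theorem not_three_fixed_of_ne_bot_cpt (hT : ∀ j, (T j).IsTree)
    (quot_isImmersion : ∀ j, SemiGraph.IsImmersion (quot j))
    (act_quot : ∀ (j : J) (g : Gtp), (ρ j g).hom ≫ quot j = quot j ≫ (levelAct j g).hom)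
    (levelTrans_id : ∀ j, levelTrans (le_refl j) = 𝟙 (level j))
    (levelTrans_comp : ∀ ⦃i j k : J⦄ (hij : i ≤ j) (hjk : j ≤ k),
      levelTrans hjk ≫ levelTrans hij = levelTrans (hij.trans hjk))
    (levelTrans_act : ∀ ⦃i j : J⦄ (h : i ≤ j) (g : Gtp),
      (levelAct j g).hom ≫ levelTrans h = levelTrans h ≫ (levelAct i g).hom)
    (trans_quot : ∀ ⦃i j : J⦄ (h : i ≤ j), f h ≫ quot i = quot j ≫ levelTrans h)
    (hnobpNCpt : ∀ (C : Subgroup c.G), IsCompact (C : Set c.G) →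
      ∀ (j₀ : J) (w : ∀ i : {i : J // j₀ ≤ i}, (level i.1).Vertex)
      (β β' : ∀ i : {i : J // j₀ ≤ i}, (level i.1).Branch),
      (∀ i, β i ≠ β' i ∧ (level i.1).abuts (β i) = some (w i) ∧ (level i.1).abuts (β' i) = some (w i)) →
      (∀ ⦃i i' : {i : J // j₀ ≤ i}⦄ (h : i.1 ≤ i'.1), (levelTrans h).vertexMap (w i') = w i ∧
        (levelTrans h).branchMap (β i') = β i ∧ (levelTrans h).branchMap (β' i') = β' i) →
      (∀ (i : {i : J // j₀ ≤ i}) (γ : C), (levelAct i.1 (ι γ)).hom.vertexMap (w i) = w i ∧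
        (levelAct i.1 (ι γ)).hom.branchMap (β i) = β i ∧
          (levelAct i.1 (ι γ)).hom.branchMap (β' i) = β' i) → C = ⊥)
    {K : Subgroup c.G} (hK : K ≠ ⊥) (hKc : IsCompact (K : Set c.G)) {x y z : ∀ j, (T j).Vertex}
    (hx : ∀ ⦃i j : J⦄ (h : i ≤ j), (f h).vertexMap (x j) = x i)
    (hy : ∀ ⦃i j : J⦄ (h : i ≤ j), (f h).vertexMap (y j) = y i)
    (hz : ∀ ⦃i j : J⦄ (h : i ≤ j), (f h).vertexMap (z j) = z i)
    (hxf : ∀ n ∈ K, ∀ j, (ρ j (ι n)).hom.vertexMap (x j) = x j)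
    (hyf : ∀ n ∈ K, ∀ j, (ρ j (ι n)).hom.vertexMap (y j) = y j)
    (hzf : ∀ n ∈ K, ∀ j, (ρ j (ι n)).hom.vertexMap (z j) = z j)
    {i₁ i₂ i₃ : J} (h₁ : x i₁ ≠ y i₁) (h₂ : y i₂ ≠ z i₂) (h₃ : x i₃ ≠ z i₃) : False := by
  have hstar := SemiGraph.hstar_of_noFixedBranchPairSystem K T hT (fun j => (ρ j).comp ι) f level
    (fun j => (levelAct j).comp ι) quot quot_isImmersion (fun j n => act_quot j (ι n)) levelTrans
    levelTrans_id levelTrans_comp (fun i j h n => levelTrans_act h (ι n)) trans_quot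
    (fun j₀ w β β' hp hc hfix => hnobpNCpt K hKc j₀ w β β' hp hc fun i γ => hfix i γ) hK
  exact SemiGraph.atMostTwo_systems_of_hstar T (fun j => ((ρ j).comp ι).comp K.subtype) f hT
    (fun j => by
      obtain ⟨i, h, heq⟩ := hstar j
      exact ⟨i, h, fun e e' he he' => heq e e' (fun γ => he γ) (fun γ => he' γ)⟩)
    hx hy hz (fun j γ => hxf γ γ.2 j) (fun j γ => hyf γ γ.2 j) (fun j γ => hzf γ γ.2 j) h₁ h₂ h₃

/-- **Input `hEinj` DISCHARGED**: two adjacent pairs `(x, y)`, `(x, y')` with the same full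
`Π^temp_𝔾`-stabiliser coincide — that stabiliser is edge-like (`hEstabN_of_edgeData`), hence infinite
(Thm 3.7 (i)(ii) discharged: `ne_bot_of_mem_edgeLikeSubgroups`), and fixes `x`, `y`, `y'`; were `y ≠ y'`,
these would be three pairwise-somewhere-different fixed systems (`not_three_fixed_of_ne_bot_cpt`).
[cite: MochizukiSemiAnbd2006, Thm 5.4 (i), p. 66] -/
theorem hEinj_of_edgeData_cpt (h𝒢 : 𝒢.Thm37Hypotheses) (hT : ∀ j, (T j).IsTree)
    (trans_act : ∀ ⦃i j : J⦄ (h : i ≤ j) (g : Gtp), (ρ j g).hom ≫ f h = f h ≫ (ρ i g).hom)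
    (quot_isImmersion : ∀ j, SemiGraph.IsImmersion (quot j))
    (act_quot : ∀ (j : J) (g : Gtp), (ρ j g).hom ≫ quot j = quot j ≫ (levelAct j g).hom)
    (levelTrans_id : ∀ j, levelTrans (le_refl j) = 𝟙 (level j))
    (levelTrans_comp : ∀ ⦃i j k : J⦄ (hij : i ≤ j) (hjk : j ≤ k),
      levelTrans hjk ≫ levelTrans hij = levelTrans (hij.trans hjk))
    (levelTrans_act : ∀ ⦃i j : J⦄ (h : i ≤ j) (g : Gtp),
      (levelAct j g).hom ≫ levelTrans h = levelTrans h ≫ (levelAct i g).hom)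
    (trans_quot : ∀ ⦃i j : J⦄ (h : i ≤ j), f h ≫ quot i = quot j ≫ levelTrans h)
    (hnobpNCpt : ∀ (C : Subgroup c.G), IsCompact (C : Set c.G) →
      ∀ (j₀ : J) (w : ∀ i : {i : J // j₀ ≤ i}, (level i.1).Vertex)
      (β β' : ∀ i : {i : J // j₀ ≤ i}, (level i.1).Branch),
      (∀ i, β i ≠ β' i ∧ (level i.1).abuts (β i) = some (w i) ∧ (level i.1).abuts (β' i) = some (w i)) →
      (∀ ⦃i i' : {i : J // j₀ ≤ i}⦄ (h : i.1 ≤ i'.1), (levelTrans h).vertexMap (w i') = w i ∧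
        (levelTrans h).branchMap (β i') = β i ∧ (levelTrans h).branchMap (β' i') = β' i) →
      (∀ (i : {i : J // j₀ ≤ i}) (γ : C), (levelAct i.1 (ι γ)).hom.vertexMap (w i) = w i ∧
        (levelAct i.1 (ι γ)).hom.branchMap (β i) = β i ∧
          (levelAct i.1 (ι γ)).hom.branchMap (β' i) = β' i) → C = ⊥)
    (hedgeN : ∀ (j₁ : J) (ε : ∀ j : {j : J // j₁ ≤ j}, (T j.1).Edge),
      (∀ ⦃i j : {j : J // j₁ ≤ j}⦄ (h : i.1 ≤ j.1), (f h).edgeMap (ε j) = ε i) →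
      ∃ (e : 𝒢.graph.Edge) (L : Subgroup c.G), L ∈ edgeLikeSubgroups c e ∧
        ∀ n : c.G, n ∈ L ↔ ∀ j, (ρ j.1 (ι n)).hom.edgeMap (ε j) = ε j ∧
          ∀ b : (T j.1).Branch, (T j.1).edgeOf b = ε j → (ρ j.1 (ι n)).hom.branchMap b = b)
    (x y y' : ∀ j, (T j).Vertex) (hx : ∀ ⦃i j : J⦄ (h : i ≤ j), (f h).vertexMap (x j) = x i)
    (hy : ∀ ⦃i j : J⦄ (h : i ≤ j), (f h).vertexMap (y j) = y i)
    (hy' : ∀ ⦃i j : J⦄ (h : i ≤ j), (f h).vertexMap (y' j) = y' i)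
    (hxy : ∃ (j₁ : J) (ε : ∀ j : {j : J // j₁ ≤ j}, (T j.1).Edge)
      (c₁ c₂ : ∀ j : {j : J // j₁ ≤ j}, (T j.1).Branch),
      ∀ j : {j : J // j₁ ≤ j}, x j.1 ≠ y j.1 ∧ (T j.1).edgeOf (c₁ j) = ε j ∧
        (T j.1).edgeOf (c₂ j) = ε j ∧ (T j.1).abuts (c₁ j) = some (x j.1) ∧ (T j.1).abuts (c₂ j) = some (y j.1))
    (hxy' : ∃ (j₁ : J) (ε : ∀ j : {j : J // j₁ ≤ j}, (T j.1).Edge)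
      (c₁ c₂ : ∀ j : {j : J // j₁ ≤ j}, (T j.1).Branch),
      ∀ j : {j : J // j₁ ≤ j}, x j.1 ≠ y' j.1 ∧ (T j.1).edgeOf (c₁ j) = ε j ∧
        (T j.1).edgeOf (c₂ j) = ε j ∧ (T j.1).abuts (c₁ j) = some (x j.1) ∧ (T j.1).abuts (c₂ j) = some (y' j.1))
    (hiff : ∀ n : c.G, ((∀ j, (ρ j (ι n)).hom.vertexMap (x j) = x j) ∧
        ∀ j, (ρ j (ι n)).hom.vertexMap (y j) = y j) ↔
      ((∀ j, (ρ j (ι n)).hom.vertexMap (x j) = x j) ∧ ∀ j, (ρ j (ι n)).hom.vertexMap (y' j) = y' j)) :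
    y = y' := by
  obtain ⟨e, K, hK, hKiff⟩ := hEstabN_of_edgeData ι T ρ f hT trans_act hedgeN x y hx hy hxy
  have hKbot : K ≠ ⊥ := ne_bot_of_mem_edgeLikeSubgroups verticialInjective_holds h𝒢 c hK
  by_contra hne
  obtain ⟨i, hi⟩ : ∃ i, y i ≠ y' i := by
    by_contra hall
    push Not at hall
    exact hne (funext hall)
  obtain ⟨j₁, ε, c₁, c₂, hdata⟩ := hxy
  obtain ⟨j₁', ε', c₁', c₂', hdata'⟩ := hxy'
  exact not_three_fixed_of_ne_bot_cpt ι T ρ f level levelAct quot levelTrans hT quot_isImmersion act_quot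
    levelTrans_id levelTrans_comp levelTrans_act trans_quot hnobpNCpt hKbot
    (isCompact_of_mem_edgeLikeSubgroups c hK) hx hy hy'
    (fun n hn j => ((hKiff n).mp hn).1 j) (fun n hn j => ((hKiff n).mp hn).2 j)
    (fun n hn j => ((hiff n).mp ((hKiff n).mp hn)).2 j)
    (hdata ⟨j₁, le_rfl⟩).1 hi (hdata' ⟨j₁', le_rfl⟩).1

/-- **Input `hErigid` DISCHARGED** (and freed of its ambient verticial subgroup): COMMENSURABLE §3
edge-like subgroups of `π₁^temp(𝒢)` are EQUAL — with the converse dictionary `hedgeFixN` (every edge-like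
subgroup is the full stabiliser of an eventual edge system with its two end systems), `K ∩ K'` is
nontrivial (edge-like subgroups are infinite) and fixes the four end systems, so by
`not_three_fixed_of_ne_bot_cpt` the two end pairs coincide as sets, hence so do the stabilisers.  No
`CompactInVerticial` (contrast abc-iut-w4-d053's `edgeLike_commensurable_rigid`).
[cite: MochizukiSemiAnbd2006, Thm 5.4 (i), p. 66] -/
theorem hErigid_of_edgeData_cpt (h𝒢 : 𝒢.Thm37Hypotheses) (hT : ∀ j, (T j).IsTree)
    (trans_act : ∀ ⦃i j : J⦄ (h : i ≤ j) (g : Gtp), (ρ j g).hom ≫ f h = f h ≫ (ρ i g).hom)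
    (quot_isImmersion : ∀ j, SemiGraph.IsImmersion (quot j))
    (act_quot : ∀ (j : J) (g : Gtp), (ρ j g).hom ≫ quot j = quot j ≫ (levelAct j g).hom)
    (levelTrans_id : ∀ j, levelTrans (le_refl j) = 𝟙 (level j))
    (levelTrans_comp : ∀ ⦃i j k : J⦄ (hij : i ≤ j) (hjk : j ≤ k),
      levelTrans hjk ≫ levelTrans hij = levelTrans (hij.trans hjk))
    (levelTrans_act : ∀ ⦃i j : J⦄ (h : i ≤ j) (g : Gtp),
      (levelAct j g).hom ≫ levelTrans h = levelTrans h ≫ (levelAct i g).hom)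
    (trans_quot : ∀ ⦃i j : J⦄ (h : i ≤ j), f h ≫ quot i = quot j ≫ levelTrans h)
    (hnobpNCpt : ∀ (C : Subgroup c.G), IsCompact (C : Set c.G) →
      ∀ (j₀ : J) (w : ∀ i : {i : J // j₀ ≤ i}, (level i.1).Vertex)
      (β β' : ∀ i : {i : J // j₀ ≤ i}, (level i.1).Branch),
      (∀ i, β i ≠ β' i ∧ (level i.1).abuts (β i) = some (w i) ∧ (level i.1).abuts (β' i) = some (w i)) →
      (∀ ⦃i i' : {i : J // j₀ ≤ i}⦄ (h : i.1 ≤ i'.1), (levelTrans h).vertexMap (w i') = w i ∧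
        (levelTrans h).branchMap (β i') = β i ∧ (levelTrans h).branchMap (β' i') = β' i) →
      (∀ (i : {i : J // j₀ ≤ i}) (γ : C), (levelAct i.1 (ι γ)).hom.vertexMap (w i) = w i ∧
        (levelAct i.1 (ι γ)).hom.branchMap (β i) = β i ∧
          (levelAct i.1 (ι γ)).hom.branchMap (β' i) = β' i) → C = ⊥)
    (hedgeFixN : ∀ (e : 𝒢.graph.Edge) (K : Subgroup c.G), K ∈ edgeLikeSubgroups c e →
      ∃ (j₁ : J) (ε : ∀ j : {j : J // j₁ ≤ j}, (T j.1).Edge) (c₁ c₂ : ∀ j : {j : J // j₁ ≤ j}, (T j.1).Branch)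
        (x₁ x₂ : ∀ j, (T j).Vertex),
        (∀ ⦃i j : J⦄ (h : i ≤ j), (f h).vertexMap (x₁ j) = x₁ i) ∧
        (∀ ⦃i j : J⦄ (h : i ≤ j), (f h).vertexMap (x₂ j) = x₂ i) ∧
        (∀ j, x₁ j.1 ≠ x₂ j.1 ∧ (T j.1).edgeOf (c₁ j) = ε j ∧ (T j.1).edgeOf (c₂ j) = ε j ∧
          (T j.1).abuts (c₁ j) = some (x₁ j.1) ∧ (T j.1).abuts (c₂ j) = some (x₂ j.1)) ∧
        ∀ n : c.G, n ∈ K ↔ ∀ j, (ρ j.1 (ι n)).hom.edgeMap (ε j) = ε j ∧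
          ∀ b : (T j.1).Branch, (T j.1).edgeOf b = ε j → (ρ j.1 (ι n)).hom.branchMap b = b)
    {e e' : 𝒢.graph.Edge} {K K' : Subgroup c.G} (hK : K ∈ edgeLikeSubgroups c e)
    (hK' : K' ∈ edgeLikeSubgroups c e') (hc : Subgroup.Commensurable K K') : K = K' := by
  -- pointwise equivariance for the restricted action
  have hequivN : ∀ ⦃i j : J⦄ (h : i ≤ j) (n : c.G) (z : (T j).Vertex),
      (f h).vertexMap (((ρ j).comp ι n).hom.vertexMap z) = ((ρ i).comp ι n).hom.vertexMap ((f h).vertexMap z) :=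
    fun i j h n z => trans_act_vertexMap' T ρ f trans_act h (ι n) z
  -- the two end pairs
  obtain ⟨j₁, ε, c₁, c₂, x, y, hx, hy, hdata, hKiff⟩ := hedgeFixN e K hK
  obtain ⟨j₁', ε', c₁', c₂', x', y', hx', hy', hdata', hK'iff⟩ := hedgeFixN e' K' hK'
  have hKp : ∀ n : c.G, n ∈ K ↔ (∀ j, (ρ j (ι n)).hom.vertexMap (x j) = x j) ∧
      ∀ j, (ρ j (ι n)).hom.vertexMap (y j) = y j := fun n => by
    rw [hKiff n]; exact edgeSystem_fixed_iff_ends_fixed T (fun j => (ρ j).comp ι) f hT hequivN hx hy hdata n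
  have hK'p : ∀ n : c.G, n ∈ K' ↔ (∀ j, (ρ j (ι n)).hom.vertexMap (x' j) = x' j) ∧
      ∀ j, (ρ j (ι n)).hom.vertexMap (y' j) = y' j := fun n => by
    rw [hK'iff n]; exact edgeSystem_fixed_iff_ends_fixed T (fun j => (ρ j).comp ι) f hT hequivN hx' hy' hdata' n
  -- `K ∩ K'` is nontrivial and fixes the four systems
  have hMbot : K ⊓ K' ≠ ⊥ := inf_ne_bot_of_commensurable_of_mem_edgeLikeSubgroups h𝒢 c hK hK' hc
  have hMc : IsCompact ((K ⊓ K' : Subgroup c.G) : Set c.G) := by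
    haveI := c.t2Space
    rw [Subgroup.coe_inf]
    exact (isCompact_of_mem_edgeLikeSubgroups c hK).inter_right
      (isCompact_of_mem_edgeLikeSubgroups c hK').isClosed
  have three := fun {a₁ a₂ a₃ : ∀ j, (T j).Vertex} (ha₁ : ∀ ⦃i j : J⦄ (h : i ≤ j), (f h).vertexMap (a₁ j) = a₁ i)
      (ha₂ : ∀ ⦃i j : J⦄ (h : i ≤ j), (f h).vertexMap (a₂ j) = a₂ i)
      (ha₃ : ∀ ⦃i j : J⦄ (h : i ≤ j), (f h).vertexMap (a₃ j) = a₃ i)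
      (h₁f : ∀ n ∈ K ⊓ K', ∀ j, (ρ j (ι n)).hom.vertexMap (a₁ j) = a₁ j)
      (h₂f : ∀ n ∈ K ⊓ K', ∀ j, (ρ j (ι n)).hom.vertexMap (a₂ j) = a₂ j)
      (h₃f : ∀ n ∈ K ⊓ K', ∀ j, (ρ j (ι n)).hom.vertexMap (a₃ j) = a₃ j)
      {i₁ i₂ i₃ : J} (h₁ : a₁ i₁ ≠ a₂ i₁) (h₂ : a₂ i₂ ≠ a₃ i₂) (h₃ : a₁ i₃ ≠ a₃ i₃) =>
    not_three_fixed_of_ne_bot_cpt ι T ρ f level levelAct quot levelTrans hT quot_isImmersion act_quot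
      levelTrans_id levelTrans_comp levelTrans_act trans_quot hnobpNCpt hMbot hMc ha₁ ha₂ ha₃ h₁f h₂f h₃f
      h₁ h₂ h₃
  have hxf : ∀ n ∈ K ⊓ K', ∀ j, (ρ j (ι n)).hom.vertexMap (x j) = x j :=
    fun n hn => ((hKp n).mp (Subgroup.mem_inf.mp hn).1).1
  have hyf : ∀ n ∈ K ⊓ K', ∀ j, (ρ j (ι n)).hom.vertexMap (y j) = y j :=
    fun n hn => ((hKp n).mp (Subgroup.mem_inf.mp hn).1).2
  have hx'f : ∀ n ∈ K ⊓ K', ∀ j, (ρ j (ι n)).hom.vertexMap (x' j) = x' j :=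
    fun n hn => ((hK'p n).mp (Subgroup.mem_inf.mp hn).2).1
  have hy'f : ∀ n ∈ K ⊓ K', ∀ j, (ρ j (ι n)).hom.vertexMap (y' j) = y' j :=
    fun n hn => ((hK'p n).mp (Subgroup.mem_inf.mp hn).2).2
  have hxy : x j₁ ≠ y j₁ := (hdata ⟨j₁, le_rfl⟩).1
  have hx'y' : x' j₁' ≠ y' j₁' := (hdata' ⟨j₁', le_rfl⟩).1
  -- a system different somewhere from both `x` and `y` cannot be fixed
  have mem_pair : ∀ {a : ∀ j, (T j).Vertex}, (∀ ⦃i j : J⦄ (h : i ≤ j), (f h).vertexMap (a j) = a i) →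
      (∀ n ∈ K ⊓ K', ∀ j, (ρ j (ι n)).hom.vertexMap (a j) = a j) → a = x ∨ a = y := by
    intro a ha haf
    by_contra hnot
    push Not at hnot
    obtain ⟨hax, hay⟩ := hnot
    obtain ⟨i, hi⟩ : ∃ i, a i ≠ x i := by
      by_contra hall; push Not at hall; exact hax (funext hall)
    obtain ⟨i', hi'⟩ : ∃ i, a i ≠ y i := by
      by_contra hall; push Not at hall; exact hay (funext hall)
    exact three hx hy ha hxf hyf haf hxy hi'.symm hi.symm
  -- hence `{x', y'} = {x, y}`, and the stabilisers agree
  have key : ∀ n : c.G, ((∀ j, (ρ j (ι n)).hom.vertexMap (x' j) = x' j) ∧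
        ∀ j, (ρ j (ι n)).hom.vertexMap (y' j) = y' j) ↔
      ((∀ j, (ρ j (ι n)).hom.vertexMap (x j) = x j) ∧ ∀ j, (ρ j (ι n)).hom.vertexMap (y j) = y j) := by
    rcases mem_pair hx' hx'f with h1 | h1 <;> rcases mem_pair hy' hy'f with h2 | h2
    · exact absurd (h1.trans h2.symm) (fun h => hx'y' (congrFun h j₁'))
    · subst h1; subst h2; exact fun n => Iff.rfl
    · subst h1; subst h2; exact fun n => and_comm
    · exact absurd (h1.trans h2.symm) (fun h => hx'y' (congrFun h j₁'))
  ext n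
  rw [hKp n, hK'p n, key n]

end ProfiniteSemiGraph

end Literature.AnabelianGeometry.SemiGraphs
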